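import Summits.Ventures.Crystal3D.Bulk.HalfTanSound
import Summits.Ventures.Crystal3D.Bulk.HalfTanSoundZPair
import Summits.Ventures.Crystal3D.Bulk.HalfTanCertZAll
import Mathlib.Data.Nat.Find
import Mathlib.Tactic.NormNum
import Mathlib.Tactic.FieldSimp
import HarnessLib

/-!
# Soundness of the trig-free Tammes-bridge certificate, II: the profile and `HalfTanWitness 0.63 0.957`

Venture `Crystal3D` (cell `pub-crystal3d`, phase 2; seat p3, mathematics and data of seat idea-2, `phase2/idea2/TAMMES-BRIDGE.md`
§F). Assembly of the certificate — in its exact-integer form `CertZ` (`HalfTanCertZ.lean`), EVALUATED BY THE KERNEL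
(`HalfTanCertZRows1/2.lean`, `HalfTanCertZAll.lean`: `CertZ.certPairZ_true`, standard axioms) and proved sound in
`HalfTanSoundZ.lean` / `HalfTanSoundZPair.lean` (`CertZ.certPairZ_sound`) — with the box-rule semantics of `HalfTanSound.lean`:
the piecewise-linear profile `halfTanProfile : ℝ → ℝ` through idea-2's 254 dyadic nodes (`0` outside `[0, w₂₅₃]`), piece
location for admissible abscissae (`w ≥ 0`, `w² (1 - κ) ≤ 1 + κ` ⇒ `w ≤ w₂₅₃` by `nodes_last`), the symmetry
`(w₁, W₁) ↔ (w₂, W₂)` (the certificate covers piece pairs `ka ≤ kb` only), nonnegativity, `F 0 = 0`, and the pole bound at the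
nodes — giving

* `halfTanPairBound : HalfTanPairBound halfTanProfile 0.63 0.957`,
* `halfTanPoleBound : HalfTanPoleBound halfTanProfile 0.63 0.957`,
* **`halfTanWitness : HalfTanWitness 0.63 0.957`.**

Downstream (idea-2's sketch, typer files): `HalfTanToProfile 0.63 0.957` (change of variables `g t = 2 arctan F(tan(t/2))`),
`Bridge 0.63 0.957`, `CapReduction 0.63`, whence `musinTarasov2012_tammes_thirteen → GapTuple 2.52 → BulkCrystallization3D 1296`.
HONEST FRAMING: elementary bookkeeping; trust base of the three theorems = the standard axioms `propext`, `Classical.choice`,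
`Quot.sound` ONLY (the certificate is replayed by kernel `decide`, the node facts `nodes_*` of `HalfTanCert.lean` likewise); the
compiled replay `certAll_true` (`native_decide`) is still used by `certPair_true` below, which nothing else depends on any more.
Nothing geometric is proved here.
-/

namespace Summit.Ventures.Crystal3D.TammesBridge

namespace CertW

open Classical

/-! ### 1. Node facts over `ℝ` -/

/-- `w`-nodes are positive after the first. [folklore] -/
theorem nodesW_succ_pos : ∀ k, k < 253 → (0 : ℚ) < nodesW[k+1]! := by
  intro k
  induction k with
  | zero => intro _; have h := (nodes_mono 0 (by norm_num)).1; rw [nodes_zero.1] at h; exact h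
  | succ n ih => intro hn; exact (ih (by omega)).trans (nodes_mono (n + 1) hn).1

/-- `w`-nodes are nonnegative. [folklore] -/
theorem nodesW_nonneg (k : ℕ) (hk : k ≤ 253) : (0 : ℚ) ≤ nodesW[k]! := by
  rcases k with _ | k
  · rw [nodes_zero.1]
  · exact (nodesW_succ_pos k (by omega)).le

/-- Slopes are nonnegative. [folklore] -/
theorem slope_nonneg (k : ℕ) (hk : k < 253) : 0 ≤ slope k := by
  have h := nodes_mono k hk
  unfold slope
  exact div_nonneg (sub_nonneg.2 h.2) (sub_nonneg.2 h.1.le)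

/-- The affine piece ends at the next node value. [folklore] -/
theorem Waff_next (k : ℕ) (hk : k < 253) : Waff k (nodesW[k+1]!) = nodesV[k+1]! := by
  have h := (nodes_mono k hk).1
  have hne : nodesW[k+1]! - nodesW[k]! ≠ 0 := sub_ne_zero.2 (ne_of_gt h)
  unfold Waff slope
  rw [div_mul_cancel₀ _ hne]
  ring

/-- On its piece the affine value is nonnegative. [folklore] -/
theorem WaffR_nonneg {k : ℕ} (hk : k < 253) {x : ℝ} (hx : (nodesW[k]! : ℝ) ≤ x) : 0 ≤ WaffR k x := by
  have hV : (0 : ℝ) ≤ (nodesV[k]! : ℝ) := by exact_mod_cast (nodes_pole k (by omega)).1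
  have hs : (0 : ℝ) ≤ (slope k : ℝ) := by exact_mod_cast slope_nonneg k hk
  unfold WaffR
  nlinarith

/-- On its piece the affine value is at most the next node value. [folklore] -/
theorem WaffR_le_next {k : ℕ} (hk : k < 253) {x : ℝ} (hx : x ≤ (nodesW[k+1]! : ℝ)) :
    WaffR k x ≤ (nodesV[k+1]! : ℝ) := by
  have h := WaffR_mono (slope_nonneg k hk) hx
  rwa [WaffR_cast, Waff_next k hk] at h

/-! ### 2. Piece location and the profile -/

/-- The piece containing an abscissa `w ∈ [0, w₂₅₃]`: the largest `k ≤ 252` with `w_k ≤ w`. [folklore] -/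
noncomputable def piece (w : ℝ) : ℕ := Nat.findGreatest (fun k => (nodesW[k]! : ℝ) ≤ w) 252

/-- **The profile** `F`: piecewise linear through the nodes on `[0, w₂₅₃]`, `0` elsewhere. [folklore] -/
noncomputable def halfTanProfile (w : ℝ) : ℝ :=
  if 0 ≤ w ∧ w ≤ (nodesW[253]! : ℝ) then WaffR (piece w) w else 0

/-- Piece location is correct. [folklore] -/
theorem piece_spec {w : ℝ} (hw0 : 0 ≤ w) (hw1 : w ≤ (nodesW[253]! : ℝ)) :
    piece w ≤ 252 ∧ (nodesW[piece w]! : ℝ) ≤ w ∧ w ≤ (nodesW[piece w + 1]! : ℝ) := by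
  refine ⟨Nat.findGreatest_le 252, ?_, ?_⟩
  · have h0 : (nodesW[0]! : ℝ) ≤ w := by rw [nodes_zero.1]; exact_mod_cast hw0
    exact Nat.findGreatest_spec (P := fun k => (nodesW[k]! : ℝ) ≤ w) (Nat.zero_le 252) h0
  · by_cases hk : piece w < 252
    · have h := Nat.findGreatest_is_greatest (P := fun k => (nodesW[k]! : ℝ) ≤ w) (n := 252) (k := piece w + 1)
        (Nat.lt_succ_self _) (by unfold piece at hk ⊢; omega)
      exact le_of_lt (lt_of_not_ge h)
    · have hk' : piece w = 252 := le_antisymm (Nat.findGreatest_le 252) (not_lt.1 hk)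
      rw [hk']
      exact hw1

/-- Admissible abscissae lie in the domain: `w² (1 - 0.63) ≤ 1.63` ⇒ `w ≤ w₂₅₃`. [folklore] -/
theorem le_last_of_adm {w : ℝ} (h : w ^ 2 * (1 - 0.63) ≤ 1 + 0.63) : w ≤ (nodesW[253]! : ℝ) := by
  have hl : ((wmax2 : ℚ) : ℝ) ≤ (nodesW[253]! : ℝ) * (nodesW[253]! : ℝ) := by exact_mod_cast nodes_last
  have hw2 : ((wmax2 : ℚ) : ℝ) = 163 / 37 := by norm_num [wmax2, kappa]
  have hW0 : (0 : ℝ) ≤ (nodesW[253]! : ℝ) := by exact_mod_cast nodesW_nonneg 253 le_rfl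
  rw [hw2] at hl
  norm_num at h
  nlinarith

/-- The profile is nonnegative. [folklore] -/
theorem halfTanProfile_nonneg (w : ℝ) : 0 ≤ halfTanProfile w := by
  unfold halfTanProfile
  split_ifs with h
  · obtain ⟨hk, hlo, -⟩ := piece_spec h.1 h.2
    exact WaffR_nonneg (by omega) hlo
  · exact le_rfl

/-- The profile vanishes at `0`. [folklore] -/
theorem halfTanProfile_zero : halfTanProfile 0 = 0 := by
  have hW0 : (0 : ℝ) ≤ (nodesW[253]! : ℝ) := by exact_mod_cast nodesW_nonneg 253 le_rfl
  unfold halfTanProfile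
  rw [if_pos ⟨le_rfl, hW0⟩]
  obtain ⟨hk, hlo, -⟩ := piece_spec (w := 0) le_rfl hW0
  -- the piece of `0` is `0`: every later node is positive
  have hp : piece 0 = 0 := by
    by_contra hne
    obtain ⟨j, hj⟩ := Nat.exists_eq_succ_of_ne_zero hne
    rw [hj] at hlo hk
    have hpos : (0 : ℝ) < (nodesW[j+1]! : ℝ) := by exact_mod_cast nodesW_succ_pos j (by omega)
    linarith
  rw [hp]
  simp [WaffR, nodes_zero.1, nodes_zero.2]

/-- On the domain the profile is the affine piece. [folklore] -/
theorem halfTanProfile_eq {w : ℝ} (hw0 : 0 ≤ w) (hw1 : w ≤ (nodesW[253]! : ℝ)) :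
    halfTanProfile w = WaffR (piece w) w := by
  unfold halfTanProfile
  rw [if_pos ⟨hw0, hw1⟩]

/-! ### 3. The certificate, unpacked per piece pair -/

/-- Every piece pair `ka ≤ kb < 253` is certified. [folklore] -/
theorem certPair_true {ka kb : ℕ} (hk : ka ≤ kb) (hkb : kb < 253) : certPair ka kb = true := by
  have h := certAll_true
  unfold certRows at h
  rw [List.all_eq_true] at h
  have hrow := h ka (List.mem_range.2 (by omega))
  rw [Nat.zero_add] at hrow
  unfold certRow at hrow
  rw [List.all_eq_true, nodes_size.2.2] at hrow
  have hpair := hrow (kb - ka) (List.mem_range.2 (by omega))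
  rwa [Nat.add_sub_cancel' hk] at hpair

/-- The target inequality on one ordered piece pair. [folklore] -/
theorem tpoly_nonpos_of_pieces {ka kb : ℕ} (hk : ka ≤ kb) (hkb : kb < 253) {w₁ w₂ c : ℝ}
    (hw₁ : I.mem ⟨nodesW[ka]!, nodesW[ka+1]!⟩ w₁) (hw₂ : I.mem ⟨nodesW[kb]!, nodesW[kb+1]!⟩ w₂) (hw₁0 : 0 ≤ w₁)
    (hw₂0 : 0 ≤ w₂) (hc1 : -1 ≤ c) (hc2 : c ≤ 1) (hcon : 4 * w₁ * w₂ * c ≤ Epoly w₁ w₂) :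
    Tpoly (WaffR ka w₁) (WaffR kb w₂) c ≤ 0 := by
  -- kernel route (standard axioms): the integer certificate `CertZ` and its soundness (`w₁, w₂ ≥ 0` is implied by the
  -- box and no longer needed; the hypotheses stay for the unchanged interface)
  have _h₁ := hw₁0
  have _h₂ := hw₂0
  exact CertZ.certPairZ_sound (by omega) hkb (CertZ.certPairZ_true hk hkb) hw₁ hw₂ hc1 hc2 hcon

/-- `Tpoly` and `Epoly` are symmetric in the two points. [folklore] -/
theorem tpoly_symm (W₁ W₂ c : ℝ) : Tpoly W₂ W₁ c = Tpoly W₁ W₂ c := by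
  unfold Tpoly; ring

/-- `Epoly` is symmetric. [folklore] -/
theorem epoly_symm (w₁ w₂ : ℝ) : Epoly w₂ w₁ = Epoly w₁ w₂ := by
  unfold Epoly; ring

/-! ### 4. The three statements -/

/-- `c_s` as a real number is `1 - 0.957²/2`. [folklore] -/
theorem cs_real : ((cs : ℚ) : ℝ) = 1 - (0.957 : ℝ) ^ 2 / 2 := by
  norm_num [cs, sChord]

/-- **The pair bound** for the profile at `(κ, s) = (0.63, 0.957)`. [folklore] -/
theorem halfTanPairBound : HalfTanPairBound halfTanProfile 0.63 0.957 := by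
  intro w₁ w₂ c hw₁0 hw₂0 hw₁a hw₂a hc1 hc2 hcon
  have hw₁1 := le_last_of_adm hw₁a
  have hw₂1 := le_last_of_adm hw₂a
  obtain ⟨hk₁, hlo₁, hhi₁⟩ := piece_spec hw₁0 hw₁1
  obtain ⟨hk₂, hlo₂, hhi₂⟩ := piece_spec hw₂0 hw₂1
  rw [halfTanProfile_eq hw₁0 hw₁1, halfTanProfile_eq hw₂0 hw₂1]
  have hcon' : 4 * w₁ * w₂ * c ≤ Epoly w₁ w₂ := by
    have : 4 * w₁ * w₂ * c - Epoly w₁ w₂ =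
        ((1 - w₁ ^ 2) * (1 - w₂ ^ 2) + 4 * w₁ * w₂ * c) - (1 / 2) * ((1 + w₁ ^ 2) * (1 + w₂ ^ 2)) := by
      unfold Epoly; ring
    linarith
  have key : Tpoly (WaffR (piece w₁) w₁) (WaffR (piece w₂) w₂) c ≤ 0 := by
    rcases le_total (piece w₁) (piece w₂) with h12 | h21
    · exact tpoly_nonpos_of_pieces h12 (by omega) ⟨hlo₁, hhi₁⟩ ⟨hlo₂, hhi₂⟩ hw₁0 hw₂0 hc1 hc2 hcon'
    · rw [← tpoly_symm]
      refine tpoly_nonpos_of_pieces h21 (by omega) ⟨hlo₂, hhi₂⟩ ⟨hlo₁, hhi₁⟩ hw₂0 hw₁0 hc1 hc2 ?_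
      rw [epoly_symm]
      linarith
  have hT : Tpoly (WaffR (piece w₁) w₁) (WaffR (piece w₂) w₂) c =
      ((1 - WaffR (piece w₁) w₁ ^ 2) * (1 - WaffR (piece w₂) w₂ ^ 2) +
        4 * WaffR (piece w₁) w₁ * WaffR (piece w₂) w₂ * c) -
      (1 - (0.957 : ℝ) ^ 2 / 2) * ((1 + WaffR (piece w₁) w₁ ^ 2) * (1 + WaffR (piece w₂) w₂ ^ 2)) := by
    unfold Tpoly; rw [cs_real]
  linarith

/-- **The pole bound** for the profile. [folklore] -/
theorem halfTanPoleBound : HalfTanPoleBound halfTanProfile 0.63 0.957 := by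
  intro w hw0 hwa
  have hw1 := le_last_of_adm hwa
  obtain ⟨hk, hlo, hhi⟩ := piece_spec hw0 hw1
  rw [halfTanProfile_eq hw0 hw1]
  have h0 : 0 ≤ WaffR (piece w) w := WaffR_nonneg (by omega) hlo
  have h1 : WaffR (piece w) w ≤ (nodesV[piece w + 1]! : ℝ) := WaffR_le_next (by omega) hhi
  have hpole : ((nodesV[piece w + 1]! : ℚ) : ℝ) * (nodesV[piece w + 1]! : ℝ) * ((1 - cs : ℚ) : ℝ) ≤ ((1 + cs : ℚ) : ℝ) := by
    exact_mod_cast (nodes_pole (piece w + 1) (by omega)).2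
  have hcs1 : ((1 - cs : ℚ) : ℝ) = (0.957 : ℝ) ^ 2 / 2 := by norm_num [cs, sChord]
  have hcs2 : ((1 + cs : ℚ) : ℝ) = 2 - (0.957 : ℝ) ^ 2 / 2 := by norm_num [cs, sChord]
  rw [hcs1, hcs2] at hpole
  have hsq : WaffR (piece w) w ^ 2 ≤ (nodesV[piece w + 1]! : ℝ) * (nodesV[piece w + 1]! : ℝ) := by nlinarith
  nlinarith

/-- **`HalfTanWitness 0.63 0.957`**: idea-2's certified profile, as a theorem (trust: the standard axioms only — the pair
bound is replayed by the kernel through `HalfTanSoundZPair` / `HalfTanCertZAll`; `Lean.ofReduceBool` enters only the unused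
`certPair_true` above). [folklore] -/
theorem halfTanWitness : HalfTanWitness 0.63 0.957 :=
  ⟨halfTanProfile, halfTanProfile_nonneg, halfTanProfile_zero, halfTanPoleBound, halfTanPairBound⟩

end CertW

/-- Re-export at the bridge namespace: `HalfTanWitness 0.63 0.957`. [folklore] -/
theorem halfTanWitness_063_0957 : HalfTanWitness 0.63 0.957 := CertW.halfTanWitness

end Summit.Ventures.Crystal3D.TammesBridge
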